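import Summits.RiemannHypothesis.RiemannHypothesis.Theorems.TiltedLandingLaw421R3ColumnImmunity2
import Summits.RiemannHypothesis.RiemannHypothesis.Theorems.TiltedLandingLaw421.Negative.AlphaSealTrkDFalse

/-!
# `RhW08.Column.LineageLawQ` is false (critic g21, rh-split-ref-2; negative lemma for crux 24774)

`LineageLawQ` (landed in `…R3ColumnImmunity2`, p770439) asks, at EVERY non-Ready′ level `j` of every legal
frame, for an upper zero `u` of `f^{(j+1)}` in `MarginBand x₀ R Hs j u`, i.e.
`(|Re u − x₀| + R/2)² + (j+1)·(Im u)² ≤ (j+1)·Hs²`.  Since `EngineHyps5 2 …` forces `2·Hs ≤ R`, the margin band is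
EMPTY for every `j < (R/(2Hs))² − 1`, in particular at `j = 0` always (`(R/2)² ≤ Hs² ≤ R²/4` would need `Im u = 0`).
So the law says «every legal frame is Ready′ at level 0», and the landed legal datum
`engineHyps5_D : EngineHyps5 2 (1/2) fW 0 (23/25) 2 40 1 64` (`fW z = z⁵ + z³`) with `not_readyR2_D` refutes it.

Consequence: `restSuccBotQ_of_lineageLaw : LineageLawQ → RestSuccBotQ` is vacuous; the lineage door as typed is closed
(the director's (CA376) strike made kernel-checked).  The intended statement (critic RESULT-21) had
`(ρ(u) + R/2)²` with `ρ(u) = max (|Re u − x₀| − R/2) 0`, i.e. `max |Re u − x₀| (R/2)` in place of `|Re u − x₀| + R/2`,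
AND the hypothesis «band_j ≠ ∅»; whether that repaired law holds is open (0 counterexamples in the critic's corpora).
Nothing here bears on the truth of RH; RH is not proved.
-/

set_option linter.dupNamespace false

namespace Summit.RiemannHypothesis.RiemannHypothesis.Theorems.TiltedLandingLaw421.Negative

open Complex

/-- `LineageLawQ` fails: instantiate at the landed legal datum `(1/2, fW, 0, 23/25, 2, 40, 1, 64)`, level `0`,
`v = I` (`not_readyR2_D`); the promised `u` would satisfy `(|Re u| + 20)² + (Im u)² ≤ 1`. -/
theorem lineageLawQ_false : ¬ RhW08.Column.LineageLawQ := by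
  intro h
  have hne : iteratedDeriv 0 fW ≠ 0 := by rw [iteratedDeriv_zero_fW]; exact fW_ne_zero
  obtain ⟨u, -, -, hband⟩ := h (1 / 2) fW 0 (23 / 25) 2 40 1 64 engineHyps5_D 0 I hne not_readyR2_D
  unfold RhW08.Column.MarginBand at hband
  simp only [Nat.cast_zero, zero_add, one_mul, sub_zero] at hband
  have h20 : (20 : ℝ) ≤ |u.re| + 40 / 2 := by linarith [abs_nonneg u.re]
  have hsq : (400 : ℝ) ≤ (|u.re| + 40 / 2) ^ 2 := by nlinarith [h20]
  nlinarith [hband, hsq, sq_nonneg u.im]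

/-- The margin band is empty below the level threshold: if `2 * Hs ≤ R`, `0 < u.im` and
`MarginBand x₀ R Hs j u` (with `0 ≤ R`) then `(R/2)² < (j+1) · Hs²`, i.e. `j + 1 > (R/(2Hs))²`. -/
theorem marginBand_level_lb {x₀ R Hs : ℝ} {j : ℕ} {u : ℂ} (hR : 0 ≤ R) (hu : 0 < u.im)
    (h : RhW08.Column.MarginBand x₀ R Hs j u) : (R / 2) ^ 2 < ((j : ℝ) + 1) * Hs ^ 2 := by
  unfold RhW08.Column.MarginBand at h
  have ha : 0 ≤ |u.re - x₀| := abs_nonneg _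
  have hj : (0 : ℝ) < (j : ℝ) + 1 := by positivity
  have hpos : 0 < ((j : ℝ) + 1) * u.im ^ 2 := mul_pos hj (pow_pos hu 2)
  have hmono : (R / 2) ^ 2 ≤ (|u.re - x₀| + R / 2) ^ 2 := by nlinarith [ha, hR]
  linarith [h, hpos, hmono]


end Summit.RiemannHypothesis.RiemannHypothesis.Theorems.TiltedLandingLaw421.Negative
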